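import Mathlib
import Summits.NavierStokesRegularity.NavierStokesRegularity.Theorems.TaoLadderRungTwoBreakOneShiftWindowRTermDSound
import HarnessLib

/-!
# The one-shift window system, XXXII: SPARSE JACOBIAN-MAGNITUDE ROWS AND THE JACOBIAN CLOSENESS ROWS of the
# term-data layer — the `R`/`Ab` (rough and centre), `Bt`, `L` and `AΔ = Bt + L·prox` data of the pair-slope step
# (parts XV/XVI) as SPARSE rows computed from the term list, with their soundness and the sparse-sum identities
# the checker relies on (cell harvest/h2-tao-ladder, seat p2; rung1/KERNEL-CHEAP-REPLAY-SPEC.md §2 (d)/(e), §6 (iii)/(iv),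
# §7 «CHECKER» (d); support for K1(1) = `NoSurvivingDSSOne`, stmt-NavierStokesRegularity-20205)

MODEL lattice ODEs only (Tao 2016 §4 normal form on Tao's shift set `S`); nothing here is a statement about
the Navier–Stokes equations; no item is closed; nothing numerical is certified. Generic in `ι` (numbered by
`e : ι ≃ Fin n`) and `κ`. Data model: part XXX (`RTermD`, `IsRTEncl`).

* `magRow prec vb row` — sparse row of Jacobian-entry MAGNITUDES: the product `q · fa · fb` contributes
  `(col fa, |q ⊗ vb fb|)` and `(col fb, |q ⊗ vb fa|)` for its coordinate factors (`vb` = value boxes over the hull: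
  `RFac.cval X` for the centre field, `RFac.rval X` for rough fields); `colVal row j` = the real sum of the entries at
  column `j`; **`abs_jacEntry_le_colVal_rough` / `_centre`**: `|∂_j F_i(x)| ≤ colVal (magRow …) (e j)` on the box;
* `jacRowR` — the interval of a rough Jacobian entry (signed; the rough diagonal bound `dg`), `mem_jacEntry_jacRowR`;
* `Btf`, `Lf` (real) and `adRow prec prox row` (sparse, executable) with **`abs_jacEntry_sub_le_Bt_L`**: the Jacobian
  closeness `|∂_j F_t,i(x) − ∂_j F_c,i(x')| ≤ Bt_ij + Σ_k L_ijk |x_k − x'_k|` of `StepSlopeData`, and the identity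
  **`Bt_add_L_prox_eq_colVal_adRow`**: `Bt_ij + Σ_k L_ijk prox_k = colVal (adRow prec prox row_i) (e j)`;
* `sum_colVal_mul` — `Σ_j colVal row (e j) · M j = Σ_{(c,r) ∈ row} r · M (e⁻¹ c)` (sparse products are exact sums).
-/

-- the sub-problem namespace repeats the summit name by design (D-0017)
set_option linter.dupNamespace false

namespace Summit.NavierStokesRegularity.NavierStokesRegularity.Theorems

namespace DSSOneShift

open Set Finset
open Summit.NavierStokesRegularity.NavierStokesRegularity.Theorems.TaylorModelCert
open Summit.NavierStokesRegularity.NavierStokesRegularity.Theorems.TaylorModelReadout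
open Summit.NavierStokesRegularity.NavierStokesRegularity.Theorems.CertificateGlueOn

/-! ### Executable data -/

namespace RFac

/-- Tube radius of a factor (`0` for a coordinate). [folklore] -/
def radD : RFac → Dyad
  | coord _ => Dyad.ofInt 0
  | ext _ rad => rad

/-- Proximity of a factor's two evaluation points (`prox c` for a coordinate, `0` for an external value). [folklore] -/
def proxD (prox : ℕ → Dyad) : RFac → Dyad
  | coord c => prox c
  | ext _ _ => Dyad.ofInt 0

/-- Real indicator `[factor = coordinate j]`. [folklore] -/
noncomputable def icn (j : ℕ) : RFac → ℝ
  | coord c => if c = j then 1 else 0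
  | ext _ _ => 0

/-- Real tube radius. [folklore] -/
noncomputable def radR : RFac → ℝ
  | coord _ => 0
  | ext _ rad => rad.toReal

end RFac

/-- The entry a factor contributes to a sparse row: `[(c, v)]` for the coordinate `c`, nothing for an external value. [folklore] -/
def RFac.entry (v : Dyad) : RFac → List (ℕ × Dyad)
  | RFac.coord c => [(c, v)]
  | RFac.ext _ _ => []

/-- **Sparse Jacobian-magnitude row** of a term row over value boxes `vb`. [cite: Moore1979, §3.2; cell vocabulary, harvest/h2-tao-ladder rung1/KERNEL-CHEAP-REPLAY-SPEC.md §2 (d) (Ā ≥ |Df| on U′)] -/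
def magRow (prec : ℕ) (vb : RFac → IntervalD) : List RTermD → List (ℕ × Dyad)
  | [] => []
  | t :: l => t.2.1.entry (IntervalD.mag (IntervalD.mulR prec t.1 (vb t.2.2))) ++
      t.2.2.entry (IntervalD.mag (IntervalD.mulR prec t.1 (vb t.2.1))) ++ magRow prec vb l

/-- The interval of a ROUGH Jacobian entry `(·, j)` of a term row over the box `X`. [cite: Moore1979, §3.2] -/
def jacRowR (prec : ℕ) (X : Array IntervalD) (j : ℕ) : List RTermD → IntervalD
  | [] => IntervalD.ofInt 0
  | t :: l => IntervalD.addR prec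
      (IntervalD.mulR prec t.1 (IntervalD.addR prec (IntervalD.mulR prec (t.2.1.isC j) (t.2.2.rval X))
        (IntervalD.mulR prec (t.2.1.rval X) (t.2.2.isC j))))
      (jacRowR prec X j l)

/-- **Sparse Jacobian-closeness row** `AΔ_i· = Bt_i· + Σ_k L_i·k prox_k` of a term row. [cite: KapelaZgliczynski2009, §4; cell vocabulary, harvest/h2-tao-ladder rung1/KERNEL-CHEAP-REPLAY-SPEC.md §6 (iv)] -/
def adRow (prox : ℕ → Dyad) : List RTermD → List (ℕ × Dyad)
  | [] => []
  | t :: l => t.2.1.entry ((IntervalD.mag t.1).mul ((t.2.2.radD).add (t.2.2.proxD prox))) ++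
      t.2.2.entry ((IntervalD.mag t.1).mul ((t.2.1.radD).add (t.2.1.proxD prox))) ++ adRow prox l

/-- The real sum of the entries of a sparse row at column `j`. [folklore] -/
noncomputable def colVal (row : List (ℕ × Dyad)) (j : ℕ) : ℝ := (row.map fun p => if p.1 = j then p.2.toReal else 0).sum

/-- `colVal` is additive over concatenation. [folklore] -/
theorem colVal_append (r s : List (ℕ × Dyad)) (j : ℕ) : colVal (r ++ s) j = colVal r j + colVal s j := by
  simp [colVal, List.map_append, List.sum_append]

/-- `colVal` of an entry. [folklore] -/
theorem colVal_entry (φ : RFac) (v : Dyad) (j : ℕ) : colVal (φ.entry v) j = φ.icn j * v.toReal := by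
  cases φ with
  | coord c => by_cases h : c = j <;> simp [RFac.entry, colVal, RFac.icn, h]
  | ext cen rad => simp [RFac.entry, colVal, RFac.icn]

/-- Entries of sparse rows are non-negative when built from magnitudes: `colVal ≥ 0` for `magRow`. [folklore] -/
theorem colVal_magRow_nonneg (prec : ℕ) (vb : RFac → IntervalD) (j : ℕ) :
    ∀ l : List RTermD, 0 ≤ colVal (magRow prec vb l) j
  | [] => by simp [magRow, colVal]
  | t :: l => by
    rw [magRow, colVal_append, colVal_append, colVal_entry, colVal_entry]
    have h1 : 0 ≤ t.2.1.icn j := by cases t.2.1 <;> simp [RFac.icn]; split_ifs <;> norm_num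
    have h2 : 0 ≤ t.2.2.icn j := by cases t.2.2 <;> simp [RFac.icn]; split_ifs <;> norm_num
    have := colVal_magRow_nonneg prec vb j l
    have m1 := mag_toReal_nonneg' (IntervalD.mulR prec t.1 (vb t.2.2))
    have m2 := mag_toReal_nonneg' (IntervalD.mulR prec t.1 (vb t.2.1))
    positivity
where
  /-- Magnitudes are non-negative. [folklore] -/
  mag_toReal_nonneg' (I : IntervalD) : 0 ≤ (IntervalD.mag I).toReal := by
    simp only [IntervalD.mag, Dyad.toReal_max, Dyad.toReal_abs]
    exact le_max_of_le_left (abs_nonneg _)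

/-! ### Real-side closeness data -/

/-- `L_{·jc}` of a term row: `Σ |q| ([fa = j][fb = c] + [fa = c][fb = j])` (coefficient magnitudes from the boxes). [cite: KapelaZgliczynski2009, §4; cell vocabulary, harvest/h2-tao-ladder rung1/KERNEL-CHEAP-REPLAY-SPEC.md §6 (iv)] -/
noncomputable def Lf (dl : List RTermD) (j c : ℕ) : ℝ :=
  (dl.map fun d => (IntervalD.mag d.1).toReal * (d.2.1.icn j * d.2.2.icn c + d.2.1.icn c * d.2.2.icn j)).sum

/-- `Bt_{·j}` of a term row: `Σ |q| ([fa = j] rad_b + rad_a [fb = j])`. [cite: KapelaZgliczynski2009, §4; cell vocabulary, harvest/h2-tao-ladder rung1/KERNEL-CHEAP-REPLAY-SPEC.md §6 (iv)] -/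
noncomputable def Btf (dl : List RTermD) (j : ℕ) : ℝ :=
  (dl.map fun d => (IntervalD.mag d.1).toReal * (d.2.1.icn j * d.2.2.radR + d.2.1.radR * d.2.2.icn j)).sum

/-! ### Soundness -/

variable {ι : Type*} [Fintype ι] [DecidableEq ι] {κ : Type*} [Fintype κ] {n : ℕ} (e : ι ≃ Fin n)
  {Tc Tt : κ → BTerm ι}

omit [Fintype ι] in
/-- For a data factor matched to real factors, the real indicator is `icn` through `e`. [folklore] -/
theorem isCoord_eq_icn {d : RFac} {φc φt : Factor ι} (h : FacOK e d φc φt) (j : ι) :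
    φc.isCoord j = d.icn (e j) ∧ φt.isCoord j = d.icn (e j) := by
  cases d with
  | coord c =>
    obtain ⟨i, hi, rfl, rfl⟩ := h
    have : (if i = j then (1 : ℝ) else 0) = if c = (e j : ℕ) then 1 else 0 := by
      by_cases hij : i = j
      · subst hij; simp [hi]
      · rw [if_neg hij, if_neg (fun h' => hij (e.injective (Fin.ext (hi.trans h'))))]
    exact ⟨this, this⟩
  | ext cen rad =>
    obtain ⟨rc, rt, rfl, rfl, -⟩ := h
    simp [Factor.isCoord, RFac.icn]

omit [Fintype ι] [DecidableEq ι] in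
/-- `icn` is an indicator. [folklore] -/
theorem icn_nonneg (d : RFac) (j : ℕ) : 0 ≤ d.icn j := by
  cases d <;> simp [RFac.icn]; split_ifs <;> norm_num

omit [Fintype ι] [Fintype κ] in
/-- One row: `|Σ coef (isC_j fa · fb x + fa x · isC_j fb)| ≤ colVal (magRow vb) (e j)` for rough or centre values. [folklore] -/
theorem abs_jacList_le_colVal (prec : ℕ) {X : Array IntervalD} {x : ι → ℝ}
    (hx : ∀ i, IntervalD.mem (x i) (IntervalD.aget X (e i))) (j : ι) (rough : Bool) :
    ∀ {dl : List RTermD} {kl : List κ}, List.Forall₂ (fun d k => TermOK e d (Tc k) (Tt k)) dl kl →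
      let T := if rough then Tt else Tc
      let vb := if rough then RFac.rval X else RFac.cval X
      |(kl.map fun k => (T k).coef * ((T k).fa.isCoord j * (T k).fb.val x + (T k).fa.val x * (T k).fb.isCoord j)).sum| ≤
        colVal (magRow prec vb dl) (e j)
  | _, _, List.Forall₂.nil => by simp [magRow, colVal]
  | _, _, List.Forall₂.cons (a := d) (b := k) h hl => by
    intro T vb
    have ih := abs_jacList_le_colVal prec hx j rough hl
    obtain ⟨hq, hcoef, hfa, hfb⟩ := h
    obtain ⟨hac, hat, -⟩ := mem_vals e hfa (X := X) hx
    obtain ⟨hbc, hbt, -⟩ := mem_vals e hfb (X := X) hx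
    have hia := isCoord_eq_icn e hfa j
    have hib := isCoord_eq_icn e hfb j
    rw [List.map_cons, List.sum_cons, magRow, colVal_append, colVal_append, colVal_entry, colVal_entry]
    refine (abs_add_le _ _).trans (add_le_add ?_ ih)
    -- the single term
    have hcoefT : (T k).coef = (Tc k).coef := by
      simp only [T]; split_ifs
      · exact hcoef
      · rfl
    have hfaI : (T k).fa.isCoord j = d.2.1.icn (e j) := by simp only [T]; split_ifs; exacts [hia.2, hia.1]
    have hfbI : (T k).fb.isCoord j = d.2.2.icn (e j) := by simp only [T]; split_ifs; exacts [hib.2, hib.1]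
    have hva : IntervalD.mem ((T k).fa.val x) (vb d.2.1) := by
      simp only [T, vb]; split_ifs; exacts [hat, hac]
    have hvb : IntervalD.mem ((T k).fb.val x) (vb d.2.2) := by
      simp only [T, vb]; split_ifs; exacts [hbt, hbc]
    have m1 : |(Tc k).coef * (T k).fb.val x| ≤ (IntervalD.mag (IntervalD.mulR prec d.1 (vb d.2.2))).toReal :=
      IntervalD.abs_le_mag (IntervalD.mem_mulR prec hq hvb)
    have m2 : |(Tc k).coef * (T k).fa.val x| ≤ (IntervalD.mag (IntervalD.mulR prec d.1 (vb d.2.1))).toReal :=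
      IntervalD.abs_le_mag (IntervalD.mem_mulR prec hq hva)
    rw [hcoefT, hfaI, hfbI]
    have e1 : (Tc k).coef * (d.2.1.icn (e j) * (T k).fb.val x + (T k).fa.val x * d.2.2.icn (e j)) =
        d.2.1.icn (e j) * ((Tc k).coef * (T k).fb.val x) + d.2.2.icn (e j) * ((Tc k).coef * (T k).fa.val x) := by ring
    rw [e1]
    refine (abs_add_le _ _).trans (add_le_add ?_ ?_)
    · rw [abs_mul, abs_of_nonneg (icn_nonneg _ _)]
      exact mul_le_mul_of_nonneg_left m1 (icn_nonneg _ _)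
    · rw [abs_mul, abs_of_nonneg (icn_nonneg _ _)]
      exact mul_le_mul_of_nonneg_left m2 (icn_nonneg _ _)

omit [Fintype ι] in
/-- **Rough Jacobian magnitudes**: `|jacEntry Tt x i j| ≤ colVal (magRow prec (rval X) (rrow RD (e i))) (e j)` on the box. [cite: Moore1979, §3.2; cell vocabulary, harvest/h2-tao-ladder rung1/KERNEL-CHEAP-REPLAY-SPEC.md §2 (d)] -/
theorem abs_jacEntry_le_colVal_rough {rows : ι → List κ} {RD : RRows} (h : IsRTEncl e Tc Tt rows RD) (prec : ℕ)
    {X : Array IntervalD} {x : ι → ℝ} (hx : ∀ i, IntervalD.mem (x i) (IntervalD.aget X (e i))) (i j : ι) :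
    |jacEntry Tt x i j| ≤ colVal (magRow prec (RFac.rval X) (rrow RD (e i))) (e j) := by
  obtain ⟨hrows, hsame, hdata⟩ := h
  have hT : jacEntry Tt x i j = ((rows i).map fun k => (Tt k).coef *
      ((Tt k).fa.isCoord j * (Tt k).fb.val x + (Tt k).fa.val x * (Tt k).fb.isCoord j)).sum := by
    rw [jacEntry]
    rw [show (fun k => (Tt k).coef * ((Tt k).fa.isCoord j * (Tt k).fb.val x + (Tt k).fa.val x * (Tt k).fb.isCoord j)) =
        (fun k => (Tc k).coef * ((Tt k).fa.isCoord j * (Tt k).fb.val x + (Tt k).fa.val x * (Tt k).fb.isCoord j)) from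
        funext fun k => by rw [(hsame k).2], ← hrows i]
    exact Finset.sum_congr rfl fun k _ => by rw [coefAt_eq_of_same hsame]
  rw [hT]
  simpa using abs_jacList_le_colVal e prec hx j true (hdata i)

omit [Fintype ι] in
/-- **Centre Jacobian magnitudes**: `|jacEntry Tc x i j| ≤ colVal (magRow prec (cval X) (rrow RD (e i))) (e j)` on the box. [cite: Moore1979, §3.2; cell vocabulary, harvest/h2-tao-ladder rung1/KERNEL-CHEAP-REPLAY-SPEC.md §2 (d)] -/
theorem abs_jacEntry_le_colVal_centre {rows : ι → List κ} {RD : RRows} (h : IsRTEncl e Tc Tt rows RD) (prec : ℕ)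
    {X : Array IntervalD} {x : ι → ℝ} (hx : ∀ i, IntervalD.mem (x i) (IntervalD.aget X (e i))) (i j : ι) :
    |jacEntry Tc x i j| ≤ colVal (magRow prec (RFac.cval X) (rrow RD (e i))) (e j) := by
  obtain ⟨hrows, -, hdata⟩ := h
  rw [jacEntry, hrows i]
  simpa using abs_jacList_le_colVal e prec hx j false (hdata i)

omit [Fintype ι] [Fintype κ] in
/-- One row of the rough Jacobian entry lies in `jacRowR`. [folklore] -/
theorem mem_jacRowR_aux (prec : ℕ) {X : Array IntervalD} {x : ι → ℝ}
    (hx : ∀ i, IntervalD.mem (x i) (IntervalD.aget X (e i))) (j : ι) :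
    ∀ {dl : List RTermD} {kl : List κ}, List.Forall₂ (fun d k => TermOK e d (Tc k) (Tt k)) dl kl →
      IntervalD.mem ((kl.map fun k => (Tc k).coef * ((Tt k).fa.isCoord j * (Tt k).fb.val x +
        (Tt k).fa.val x * (Tt k).fb.isCoord j)).sum) (jacRowR prec X (e j) dl)
  | _, _, List.Forall₂.nil => by simpa [jacRowR] using IntervalD.mem_ofInt 0
  | _, _, List.Forall₂.cons (a := d) (b := k) h hl => by
    obtain ⟨hq, -, hfa, hfb⟩ := h
    obtain ⟨-, hat, -⟩ := mem_vals e hfa (X := X) hx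
    obtain ⟨-, hbt, -⟩ := mem_vals e hfb (X := X) hx
    have hia : IntervalD.mem ((Tt k).fa.isCoord j) (d.2.1.isC (e j)) := by
      rw [(isCoord_eq_icn e hfa j).2, ← (isCoord_eq_icn e hfa j).1]; exact mem_isC e hfa j
    have hib : IntervalD.mem ((Tt k).fb.isCoord j) (d.2.2.isC (e j)) := by
      rw [(isCoord_eq_icn e hfb j).2, ← (isCoord_eq_icn e hfb j).1]; exact mem_isC e hfb j
    rw [List.map_cons, List.sum_cons, jacRowR]
    exact IntervalD.mem_addR prec (IntervalD.mem_mulR prec hq (IntervalD.mem_addR prec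
      (IntervalD.mem_mulR prec hia hbt) (IntervalD.mem_mulR prec hat hib))) (mem_jacRowR_aux prec hx j hl)

omit [Fintype ι] in
/-- **The rough Jacobian entry over a box**: `jacEntry Tt x i j ∈ jacRowR prec X (e j) (rrow RD (e i))` (its `hi` is
the rough diagonal bound `dg`). [cite: Moore1979, §3.2; cell vocabulary, harvest/h2-tao-ladder rung1/KERNEL-CHEAP-REPLAY-SPEC.md §2 (d)] -/
theorem mem_jacEntry_jacRowR {rows : ι → List κ} {RD : RRows} (h : IsRTEncl e Tc Tt rows RD) (prec : ℕ)
    {X : Array IntervalD} {x : ι → ℝ} (hx : ∀ i, IntervalD.mem (x i) (IntervalD.aget X (e i))) (i j : ι) :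
    IntervalD.mem (jacEntry Tt x i j) (jacRowR prec X (e j) (rrow RD (e i))) := by
  obtain ⟨hrows, hsame, hdata⟩ := h
  have hT : jacEntry Tt x i j = ((rows i).map fun k => (Tc k).coef *
      ((Tt k).fa.isCoord j * (Tt k).fb.val x + (Tt k).fa.val x * (Tt k).fb.isCoord j)).sum := by
    rw [jacEntry, ← hrows i]
    exact Finset.sum_congr rfl fun k _ => by rw [coefAt_eq_of_same hsame]
  rw [hT]
  exact mem_jacRowR_aux e prec hx j (hdata i)

end DSSOneShift

end Summit.NavierStokesRegularity.NavierStokesRegularity.Theorems
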